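import Mathlib
import Summits.NavierStokesRegularity.NavierStokesRegularity.Theorems.StretchingWellBindingEnstrophyQuarterLawEnvelopeCore
import Summits.NavierStokesRegularity.NavierStokesRegularity.Theorems.StretchingWellBindingEnstrophyQuarterLawSieveTools
import Literature.Analysis.FluidPDE.CKNMorreyPressureEstimates
import HarnessLib

/-!
# Shelf crux `EnstrophyQuarterLaw` (stmt-NavierStokesRegularity-1574), line «sparse_sieve»:
# the SMOOTHING ENVELOPE `stub_smoothingEnvelope` (S3, known)

Theorems file (seat ns-hhe-c1 g2; `--supports` the shelf crux; the registered stub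
`stub_smoothingEnvelope` of the skeleton of record `Cruxes/EnstrophyQuarterLaw/Lines/sparse_sieve.lean`
— also stub 3 of `Lines/sparse_sieve_hhe.lean` on item stmt-NavierStokesRegularity-25161 — with the
Cruxes-local predicate `SmoothingEnvelope T u` UNFOLDED VERBATIM, because a Theorems file cannot
import the skeleton; the stub closes there by `exact Theorems.EnstrophyQuarterLaw.SparseSieve.stub_smoothingEnvelope`).
Navier–Stokes regularity is NOT proved by anything here; this is the KNOWN piece (localized
smoothing, Barker–Prange 2020 Thm 1 / Kang–Miura–Tsai 2021 Thm 1.1) of the line, whose OPEN pieces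
`UniformLocalTypeI`, `UniformSparseness` and `NoTypeII` are untouched.

## Proof

`gradient_envelope_core` (previous file) gives, for `M > 0`, constants `γ, σ, C₁` such that after an
INTERIOR restart at `t₀ = b − σR² > 0` with uniform local energy `≤ M R` at scale `R` and smallness
`∫_{B(x₀,2R)} |u(t₀)|³ ≤ γ³`, `‖Du(t)(y)‖ ≤ C₁ν/R²` on `(b − σR²/2, b) × B(x₀, R/3)`. Integrating
the square over `(t₁, b) × B(x₀, R/4)`, `t₁ ≥ b − σR²/4`, gives `C (b − t₁)/R` with
`C = L² |B₁| / 64`, `L = 16 C₁ ν / 9` (`setLIntegral_sq_le_of_pointwise`). The registered predicate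
also allows the BOUNDARY restart time `b − σR² = 0`, where the smallness is a statement about the
datum `u 0`: we run the stub with the halved threshold `γ/2`, so that by joint continuity of `u` on
`[0, T) × ℝ³` (`exists_forall_lintegral_cube_le_of_lt`) the smallness `≤ γ³` persists at small
positive times, and restart at `t₀' = min(δ/2, b/4) > 0` with the slightly smaller scale
`R' = √(R² − t₀'/σ) ∈ [3R/4, R]` (so that `t₀' + σR'² = b`): the interior case then covers
`(t₁, b) × B(x₀, R/4) ⊆ ((b + t₀')/2, b) × B(x₀, R'/3)` with the bound `C₁ν/R'² ≤ L/R²`.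

References: T. Barker, C. Prange, ARMA 236 (2020) = arXiv:1812.09115, Thm 1; K. Kang, H. Miura,
T.-P. Tsai, IMRN 2021, Thm 1.1 (tree: `BarkerPrange2020_thm1_slab_bounds`, p607305).
-/

noncomputable section

-- the summit and its single sub-problem share the name (CONVENTIONS §1), as in every Theorems file
set_option linter.dupNamespace false

namespace Summit.NavierStokesRegularity.NavierStokesRegularity.Theorems.EnstrophyQuarterLaw.SparseSieve

open MeasureTheory Set Metric Filter Topology Function
open Literature.Analysis Literature.Analysis.FluidPDE
open scoped ENNReal NNReal

/-! ### Integrating a pointwise gradient bound over a thin cylinder -/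

/-- A pointwise bound `‖Du(t)(y)‖ ≤ L` on `(t₁, b) × B(x₀, ρ)` integrates to
`∫_{t₁}^{b} ∫_{B(x₀,ρ)} ‖Du‖² ≤ L² · ρ³|B₁| · (b − t₁)`. [folklore] -/
theorem setLIntegral_sq_le_of_pointwise
    {u : ℝ → EuclideanSpace ℝ (Fin 3) → EuclideanSpace ℝ (Fin 3)} {t₁ b ρ L : ℝ}
    {x₀ : EuclideanSpace ℝ (Fin 3)} (hρ : 0 ≤ ρ)
    (h : ∀ t ∈ Ioo t₁ b, ∀ y ∈ ball x₀ ρ, ‖fderiv ℝ (u t) y‖ ≤ L) :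
    ∫⁻ t in Ioo t₁ b, ∫⁻ y in ball x₀ ρ, ‖fderiv ℝ (u t) y‖ₑ ^ 2 ≤
      ENNReal.ofReal (L ^ 2 * (ρ ^ 3 * (volume (ball (0 : EuclideanSpace ℝ (Fin 3)) 1)).toReal) *
        (b - t₁)) := by
  have hvol := volume_ball_fin3_eq_ofReal x₀ hρ
  have hinner : ∀ t ∈ Ioo t₁ b, ∫⁻ y in ball x₀ ρ, ‖fderiv ℝ (u t) y‖ₑ ^ 2 ≤
      ENNReal.ofReal (L ^ 2 * (ρ ^ 3 * (volume (ball (0 : EuclideanSpace ℝ (Fin 3)) 1)).toReal)) := by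
    intro t ht
    calc ∫⁻ y in ball x₀ ρ, ‖fderiv ℝ (u t) y‖ₑ ^ 2
        ≤ ∫⁻ _ in ball x₀ ρ, ENNReal.ofReal (L ^ 2) := by
          refine setLIntegral_mono' measurableSet_ball fun y hy => ?_
          rw [← ofReal_norm, ← ENNReal.ofReal_pow (norm_nonneg _)]
          exact ENNReal.ofReal_le_ofReal (pow_le_pow_left₀ (norm_nonneg _) (h t ht y hy) 2)
      _ = ENNReal.ofReal (L ^ 2 * (ρ ^ 3 * (volume (ball (0 : EuclideanSpace ℝ (Fin 3)) 1)).toReal)) := by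
          rw [setLIntegral_const, hvol, ← ENNReal.ofReal_mul (sq_nonneg _)]
  calc ∫⁻ t in Ioo t₁ b, ∫⁻ y in ball x₀ ρ, ‖fderiv ℝ (u t) y‖ₑ ^ 2
      ≤ ENNReal.ofReal (L ^ 2 * (ρ ^ 3 * (volume (ball (0 : EuclideanSpace ℝ (Fin 3)) 1)).toReal)) *
          ENNReal.ofReal (b - t₁) := setLIntegral_Ioo_le_of_le hinner
    _ = _ := by rw [← ENNReal.ofReal_mul (by positivity)]

/-! ### Smallness of the local `L³` mass persists for a short time (the boundary restart time) -/

/-- **Short-time persistence of local `L³` smallness** for a field jointly continuous on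
`[0, T) × ℝ³`: if `∫_{B(x₀,ρ)} |u(0)|³ ≤ A³` and `A < B`, then `∫_{B(x₀,ρ)} |u(s)|³ ≤ B³` for all
sufficiently small `s ≥ 0` (uniform continuity of `|u|³` on the compact set
`[0, T/2] × B̄(x₀, |ρ|)`). [folklore] -/
theorem exists_forall_lintegral_cube_le_of_lt {T : ℝ}
    {u : ℝ → EuclideanSpace ℝ (Fin 3) → EuclideanSpace ℝ (Fin 3)}
    (hu : ContinuousOn (uncurry u) (Ico 0 T ×ˢ univ)) (hT : 0 < T)
    (x₀ : EuclideanSpace ℝ (Fin 3)) (ρ : ℝ) {A B : ℝ} (hA : 0 ≤ A) (hAB : A < B)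
    (h0 : ∫⁻ y in ball x₀ ρ, ‖u 0 y‖ₑ ^ 3 ≤ ENNReal.ofReal (A ^ 3)) :
    ∃ δ > 0, ∀ s ∈ Ico 0 δ, s < T ∧ ∫⁻ y in ball x₀ ρ, ‖u s y‖ₑ ^ 3 ≤ ENNReal.ofReal (B ^ 3) := by
  -- the compact set and the uniformly continuous function `|u|³`
  set K : Set (ℝ × EuclideanSpace ℝ (Fin 3)) := Icc 0 (T / 2) ×ˢ closedBall x₀ |ρ| with hK
  have hKc : IsCompact K := isCompact_Icc.prod (isCompact_closedBall _ _)
  have hKsub : K ⊆ Ico 0 T ×ˢ univ :=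
    prod_mono (fun s hs => ⟨hs.1, lt_of_le_of_lt hs.2 (by linarith)⟩) (subset_univ _)
  set F : ℝ × EuclideanSpace ℝ (Fin 3) → ℝ := fun q => ‖uncurry u q‖ ^ 3 with hF
  have hFc : ContinuousOn F K := ((hu.mono hKsub).norm).pow 3
  have hUC := hKc.uniformContinuousOn_of_continuous hFc
  -- volume of the ball and the gap
  set V : ℝ := (volume (ball x₀ ρ)).toReal with hV
  have hV0 : 0 ≤ V := ENNReal.toReal_nonneg
  have hVeq : volume (ball x₀ ρ) = ENNReal.ofReal V := (ENNReal.ofReal_toReal measure_ball_lt_top.ne).symm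
  have hgap : 0 < B ^ 3 - A ^ 3 := by
    have : A ^ 3 < B ^ 3 := pow_lt_pow_left₀ hAB hA (by norm_num)
    linarith
  set η : ℝ := (B ^ 3 - A ^ 3) / (V + 1) with hη
  have hη0 : 0 < η := div_pos hgap (by linarith)
  have hηV : A ^ 3 + η * V ≤ B ^ 3 := by
    have h1 : η * (V + 1) = B ^ 3 - A ^ 3 := by rw [hη]; field_simp
    nlinarith
  obtain ⟨δ₀, hδ₀, hδ⟩ := Metric.uniformContinuousOn_iff.1 hUC η hη0
  refine ⟨min δ₀ (T / 2), lt_min hδ₀ (by positivity), fun s hs => ?_⟩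
  have hsδ : s < δ₀ := lt_of_lt_of_le hs.2 (min_le_left _ _)
  have hsT2 : s < T / 2 := lt_of_lt_of_le hs.2 (min_le_right _ _)
  refine ⟨by linarith, ?_⟩
  -- pointwise: `|u(s,y)|³ ≤ |u(0,y)|³ + η` on the ball
  have hpt : ∀ y ∈ ball x₀ ρ, ‖u s y‖ₑ ^ 3 ≤ ‖u 0 y‖ₑ ^ 3 + ENNReal.ofReal η := by
    intro y hy
    have hyK : y ∈ closedBall x₀ |ρ| :=
      mem_closedBall.2 ((mem_ball.1 hy).le.trans (le_abs_self ρ))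
    have hq : ((s, y) : ℝ × EuclideanSpace ℝ (Fin 3)) ∈ K := ⟨⟨hs.1, hsT2.le⟩, hyK⟩
    have hq0 : (((0 : ℝ), y) : ℝ × EuclideanSpace ℝ (Fin 3)) ∈ K :=
      ⟨⟨le_rfl, by positivity⟩, hyK⟩
    have hdist : dist ((s, y) : ℝ × EuclideanSpace ℝ (Fin 3)) ((0 : ℝ), y) < δ₀ := by
      rw [Prod.dist_eq, dist_self, Real.dist_eq, sub_zero, abs_of_nonneg hs.1, max_eq_left hs.1]
      exact hsδ
    have h1 := hδ _ hq _ hq0 hdist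
    rw [Real.dist_eq] at h1
    have h2 : ‖u s y‖ ^ 3 ≤ ‖u 0 y‖ ^ 3 + η := by
      have := (abs_lt.1 h1).2
      simp only [hF, uncurry] at this
      linarith
    rw [← ofReal_norm, ← ofReal_norm, ← ENNReal.ofReal_pow (norm_nonneg _),
      ← ENNReal.ofReal_pow (norm_nonneg _), ← ENNReal.ofReal_add (by positivity) hη0.le]
    exact ENNReal.ofReal_le_ofReal h2
  calc ∫⁻ y in ball x₀ ρ, ‖u s y‖ₑ ^ 3
      ≤ ∫⁻ y in ball x₀ ρ, (‖u 0 y‖ₑ ^ 3 + ENNReal.ofReal η) := setLIntegral_mono' measurableSet_ball hpt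
    _ = (∫⁻ y in ball x₀ ρ, ‖u 0 y‖ₑ ^ 3) + ENNReal.ofReal η * volume (ball x₀ ρ) := by
        rw [lintegral_add_right _ measurable_const, setLIntegral_const]
    _ ≤ ENNReal.ofReal (A ^ 3) + ENNReal.ofReal η * ENNReal.ofReal V := by rw [hVeq]; gcongr
    _ = ENNReal.ofReal (A ^ 3 + η * V) := by
        rw [← ENNReal.ofReal_mul hη0.le, ← ENNReal.ofReal_add (by positivity) (by positivity)]
    _ ≤ ENNReal.ofReal (B ^ 3) := ENNReal.ofReal_le_ofReal hηV

/-! ### The registered stub `stub_smoothingEnvelope` -/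

set_option maxHeartbeats 400000 in
/-- **Smoothing envelope** — the registered stub `stub_smoothingEnvelope` (S3, KNOWN) of line
«sparse_sieve» on the shelf crux `EnstrophyQuarterLaw` (stmt-NavierStokesRegularity-1574; also
stub 3 on item stmt-NavierStokesRegularity-25161), with `SmoothingEnvelope T u` UNFOLDED VERBATIM:
for a maximal classical solution on `[0, T)`, Leray–Hopf from a rapidly decaying datum, and every
scale-`r₀` local energy bound with constant `M`, there are `γ, σ > 0`, `C ≥ 0` such that for
`0 < R ≤ r₀`, `0 ≤ b − σR²`, `b ≤ T`, smallness `∫_{B(x₀,2R)} |u(b − σR²)|³ ≤ γ³` forces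
`∫_{t₁}^{b} ∫_{B(x₀,R/4)} ‖Du‖² ≤ C (b − t₁)/R` for all `t₁ ∈ [b − σR²/4, b)` (Barker–Prange 2020
Thm 1 = Kang–Miura–Tsai 2021 Thm 1.1, quantitative, rescaled and restarted:
`gradient_envelope_core`; boundary restart time by `exists_forall_lintegral_cube_le_of_lt`).
HONEST FRAMING: an a-priori statement about a GIVEN classical solution; no summit statement is
proved. [cite: BarkerPrange2020, Thm 1 (arXiv:1812.09115 p. 2)] -/
theorem stub_smoothingEnvelope : ∀ (ν T : ℝ), 0 < ν → 0 < T →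
    ∀ (u : ℝ → EuclideanSpace ℝ (Fin 3) → EuclideanSpace ℝ (Fin 3))
      (p : ℝ → EuclideanSpace ℝ (Fin 3) → ℝ),
    IsMaximalSmoothSolution ν 0 u p T → IsLerayHopfOn T ν 0 (u 0) u →
    HasRapidSpatialDecay (u 0) →
    ∀ M r₀ : ℝ, 0 < M → 0 < r₀ →
      (∀ s ∈ Set.Ico 0 T, ∀ (x : EuclideanSpace ℝ (Fin 3)), ∀ R ∈ Set.Ioc 0 r₀,
        ∫⁻ y in Metric.ball x R, ‖u s y‖ₑ ^ 2 ≤ ENNReal.ofReal (M * R)) →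
      ∃ γ σ C : ℝ, 0 < γ ∧ 0 < σ ∧ 0 ≤ C ∧
        ∀ (b R : ℝ) (x₀ : EuclideanSpace ℝ (Fin 3)), 0 < R → R ≤ r₀ → 0 ≤ b - σ * R ^ 2 → b ≤ T →
          ∫⁻ y in Metric.ball x₀ (2 * R), ‖u (b - σ * R ^ 2) y‖ₑ ^ 3 ≤ ENNReal.ofReal (γ ^ 3) →
          ∀ t₁ ∈ Set.Ico (b - σ * R ^ 2 / 4) b,
            ∫⁻ t in Set.Ioo t₁ b, ∫⁻ y in Metric.ball x₀ (R / 4), ‖fderiv ℝ (u t) y‖ₑ ^ 2 ≤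
              ENNReal.ofReal (C * (b - t₁) / R) := by
  intro ν T hν hT u p hmax hLH _hdec M r₀ hM hr₀ hA
  have hcl : IsClassicalNSSolutionOn (Ico 0 T) ν 0 u p := hmax.1
  obtain ⟨γ, σ, C₁, hγ, hσ, hC₁, hcore⟩ := gradient_envelope_core hν hT hcl hLH hM
  set V₁ : ℝ := (volume (ball (0 : EuclideanSpace ℝ (Fin 3)) 1)).toReal with hV₁
  have hV₁0 : 0 ≤ V₁ := ENNReal.toReal_nonneg
  set L : ℝ := 16 * C₁ * ν / 9 with hLdef
  have hL0 : 0 ≤ L := by positivity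
  set C : ℝ := L ^ 2 * V₁ / 64 with hCdef
  refine ⟨γ / 2, σ, C, by positivity, hσ, by positivity, ?_⟩
  intro b R x₀ hR hRr₀ ht₀ hb hsmall t₁ ht₁
  have hσR : 0 < σ * R ^ 2 := by positivity
  have hb0 : 0 < b := by linarith
  have ht₁b : t₁ < b := ht₁.2
  -- ### the pointwise envelope on `(t₁, b) × B(x₀, R/4)`
  have hpt : ∀ t ∈ Ioo t₁ b, ∀ y ∈ ball x₀ (R / 4), ‖fderiv ℝ (u t) y‖ ≤ L / R ^ 2 := by
    -- a restart at `t₀' > 0` with scale `R' ∈ [3R/4, R]`, `t₀' + σ R'² = b`, smallness `≤ γ³` at `t₀'`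
    have key : ∀ t₀' R' : ℝ, 0 < t₀' → 0 < R' → R' ≤ R → 9 * R ^ 2 / 16 ≤ R' ^ 2 →
        t₀' + σ * R' ^ 2 = b → t₀' + σ * R' ^ 2 / 2 ≤ b - σ * R ^ 2 / 4 →
        ∫⁻ y in ball x₀ (2 * R'), ‖u t₀' y‖ₑ ^ 3 ≤ ENNReal.ofReal (γ ^ 3) →
        ∀ t ∈ Ioo t₁ b, ∀ y ∈ ball x₀ (R / 4), ‖fderiv ℝ (u t) y‖ ≤ L / R ^ 2 := by
      intro t₀' R' ht₀' hR' hR'R hR'2 hfit h2t hsm t ht y hy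
      have hσR' : 0 < σ * R' ^ 2 := by positivity
      have ht₀'T : t₀' < T := by linarith
      have hL2 : ∀ x₁ : EuclideanSpace ℝ (Fin 3),
          ∫⁻ z in ball x₁ R', ‖u t₀' z‖ₑ ^ 2 ≤ ENNReal.ofReal (M * R') :=
        fun x₁ => hA t₀' ⟨ht₀'.le, ht₀'T⟩ x₁ R' ⟨hR', hR'R.trans hRr₀⟩
      have htI : t ∈ Ioo (t₀' + σ * R' ^ 2 / 2) (t₀' + σ * R' ^ 2) := by
        constructor
        · linarith [ht.1, ht₁.1]
        · linarith [ht.2]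
      have hyI : y ∈ ball x₀ (R' / 3) := by
        refine mem_ball.2 (lt_of_lt_of_le (mem_ball.1 hy) ?_)
        nlinarith
      have h := hcore t₀' R' x₀ ht₀' hR' (by linarith) hL2 hsm t htI y hyI
      refine h.trans ?_
      rw [hLdef, div_le_div_iff₀ (by positivity) (by positivity)]
      nlinarith [hC₁, hν]
    rcases eq_or_lt_of_le ht₀ with heq | hpos
    · -- boundary restart time: `b = σ R²`, the smallness is about `u 0`
      have hbσ : b = σ * R ^ 2 := by linarith
      have h0 : ∫⁻ y in ball x₀ (2 * R), ‖u 0 y‖ₑ ^ 3 ≤ ENNReal.ofReal ((γ / 2) ^ 3) := by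
        rw [heq]; exact hsmall
      obtain ⟨δ, hδ, hδs⟩ := exists_forall_lintegral_cube_le_of_lt (A := γ / 2) (B := γ)
        hcl.smooth_velocity.continuousOn hT x₀ (2 * R) (by positivity) (by linarith) h0
      set t₀' : ℝ := min (δ / 2) (b / 4) with ht₀'def
      have ht₀'pos : 0 < t₀' := lt_min (by positivity) (by positivity)
      have ht₀'δ : t₀' < δ := lt_of_le_of_lt (min_le_left _ _) (by linarith)
      have ht₀'b : t₀' ≤ b / 4 := min_le_right _ _
      have hsq : 0 < R ^ 2 - t₀' / σ := by
        have h1 : t₀' / σ ≤ R ^ 2 / 4 := by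
          rw [div_le_iff₀ hσ]; nlinarith
        nlinarith
      set R' : ℝ := Real.sqrt (R ^ 2 - t₀' / σ) with hR'def
      have hR'pos : 0 < R' := Real.sqrt_pos.2 hsq
      have hR'sq : R' ^ 2 = R ^ 2 - t₀' / σ := Real.sq_sqrt hsq.le
      have hR'R : R' ≤ R := by
        have h1 : R' ^ 2 ≤ R ^ 2 := by
          rw [hR'sq]; have : 0 ≤ t₀' / σ := by positivity
          linarith
        exact (pow_le_pow_iff_left₀ hR'pos.le hR.le two_ne_zero).1 h1
      have hR'2 : 9 * R ^ 2 / 16 ≤ R' ^ 2 := by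
        rw [hR'sq]
        have h1 : t₀' / σ ≤ R ^ 2 / 4 := by
          rw [div_le_iff₀ hσ]; nlinarith
        nlinarith
      have hfit : t₀' + σ * R' ^ 2 = b := by
        rw [hR'sq, mul_sub, mul_div_cancel₀ _ hσ.ne']; linarith
      have hsm : ∫⁻ y in ball x₀ (2 * R'), ‖u t₀' y‖ₑ ^ 3 ≤ ENNReal.ofReal (γ ^ 3) :=
        (lintegral_mono_set (ball_subset_ball (by linarith))).trans
          (hδs t₀' ⟨ht₀'pos.le, ht₀'δ⟩).2
      exact key t₀' R' ht₀'pos hR'pos hR'R hR'2 hfit (by nlinarith) hsm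
    · -- interior restart time `t₀ = b − σR² > 0`
      have hsm : ∫⁻ y in ball x₀ (2 * R), ‖u (b - σ * R ^ 2) y‖ₑ ^ 3 ≤ ENNReal.ofReal (γ ^ 3) :=
        hsmall.trans (ENNReal.ofReal_le_ofReal (by
          have : (γ / 2) ^ 3 = γ ^ 3 / 8 := by ring
          nlinarith [pow_pos hγ 3]))
      exact key (b - σ * R ^ 2) R hpos hR le_rfl (by nlinarith) (by ring) (by nlinarith) hsm
  -- ### integrate
  have hint := setLIntegral_sq_le_of_pointwise (u := u) (x₀ := x₀) (ρ := R / 4)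
    (by positivity) hpt
  refine hint.trans (le_of_eq ?_)
  congr 1
  rw [hCdef, hV₁]
  field_simp
  ring

end Summit.NavierStokesRegularity.NavierStokesRegularity.Theorems.EnstrophyQuarterLaw.SparseSieve

end
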